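import Summits.CriticalPhenomena.Ising3DConformalLimit.Theses.GaussianScaleMixture
import Summits.CriticalPhenomena.Ising3DConformalLimit.Theorems.HyperoctahedralRPLimitRotationInvariantBoostEntireOfTypeAxis
import Summits.CriticalPhenomena.Ising3DConformalLimit.Theorems.HyperoctahedralRPLimitRotationInvariantAxisSigmaOfUnit
import Summits.CriticalPhenomena.Ising3DConformalLimit.Theorems.HyperoctahedralRPLimitRotationInvariantFourfoldToFull
import Summits.CriticalPhenomena.Ising3DConformalLimit.Theorems.HyperoctahedralRPLimitRotationInvariantLimitRegularity
import Summits.CriticalPhenomena.Ising3DConformalLimit.Theorems.HyperoctahedralRPLimitRotationInvariantNineMirrorRP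
import Summits.CriticalPhenomena.Ising3DConformalLimit.Theorems.HyperoctahedralRPLimitRotationInvariantInPlaneLightCone
import Summits.CriticalPhenomena.Ising3DConformalLimit.Theorems.HyperoctahedralRPLimitRotationInvariantDiamondCross
import Literature.Analysis.Complex.PeriodicEntireLiouville
import HarnessLib

/-!
# `RotationUpgradeFromTwoPoint` (item stmt-CriticalPhenomena-8367) follows from the AXIS SIGMA BOUND

THEOREM-ONLY file (no definitions).  Crux (N) of route GaussianScaleMixture,
`RotationUpgradeFromTwoPoint`: every normalised, non-degenerate, translation-invariant, scale-covariant
pointwise scaling limit `S` of `criticalCorr 3` with ROUND two-point function (hypothesis (H7)) is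
`IsRotationInvariant`.

**Reduction.**  The landed stubs of the line `quarter-turn-liouville` for the sibling crux
`HyperoctahedralRP.LimitRotationInvariant` (stmt-CriticalPhenomena-1980) —
`stub_limitRegularity`, `stub_nineMirrorRP`, `stub_diamondCross`, `stub_inPlaneLightCone`,
`stub_boostEntireOfType`, `stub_fourfoldToFull` (all in
`Theorems/HyperoctahedralRPLimitRotationInvariant*.lean`, sorry-free) — use the hypothesis `HRP2Rigidity` of
that crux ONLY to obtain `O(3)` invariance at level `n = 2`, the base of a strong induction on the level.
For the present crux that base case is exactly hypothesis (H7) (model-blind: translation invariance + round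
`S₂(0, ·)`, coincident pairs included).  Hence the same induction proves

  `(∀ instances of (H1)–(H7), TwoSidedSigmaBound Δ S) → RotationUpgradeFromTwoPoint`

(`rotationUpgradeFromTwoPoint_of_twoSidedSigmaBound`), where `TwoSidedSigmaBound` is that line's vocabulary
(`Theorems/HyperoctahedralRPLimitRotationInvariantQuarterTurnDefs.lean`): the correlation-function form of
`‖e^{-uH} σ̂(y) e^{-vH}‖ ≤ C (u^{-Δ} + v^{-Δ})` in the Osterwalder–Schrader space of each lattice frame; true
for the generalised free field of dimension `Δ ≥ 1/2`, OPEN for the Ising₃ limit — the one open stub of that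
line (whose lead has reduced it further to the frame-`e₀` instance, S3' `stub_axisSigmaBound`; the engine
`rotInvAt_all_of_boostEntire` below is stated over an abstract inductive-step provider, so the axis form
plugs in verbatim through `stub_boostEntireOfTypeAxis`).  So the two isotropy cruxes stmt-1980 and stmt-8367
are closed modulo ONE AND THE SAME open energy bound; for stmt-8367 it is moreover only needed for families
with round `S₂`.  The axis form is `rotationUpgradeFromTwoPoint_of_axisSigmaBound` (same proof through
`stub_boostEntireOfTypeAxis`).

Inductive step (levels `n ≥ 3`): `stub_boostEntireOfType` makes the orbit function
`θ ↦ S n (rot θ ∘ x)` of an axis-generic configuration the restriction of an entire function of exponential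
type `< 4`; hyperoctahedral invariance of the limit (`orbit_periodic`) makes it `π/2`-periodic on `ℝ`, hence on
`ℂ` (identity theorem); the tree's Liouville theorem for periodic entire functions of small type
(`Literature.Analysis.Complex.apply_eq_apply_of_periodic_of_norm_le_exp`, `T = π/2`, `τ T < 2π`) makes it
constant; `stub_fourfoldToFull` upgrades axis-generic invariance about `e₂` to `O(3)` at level `n`.
Levels `0, 1` are trivial (empty configuration; translation invariance).  The per-instance form
`isRotationInvariant_of_axisSigmaBound` is re-exported under the registered name `stub_sigmaBoundGraft`
(STUB 6 of the skeleton of line `null-laplacian-edge-gaussianity`, namespace `…NullLaplacianEdgeGaussianity`).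
-/

noncomputable section

open scoped BigOperators Topology
open Literature.Probability.LatticeModels
open Literature.MathematicalPhysics.QuantumFieldTheory
open Summit.CriticalPhenomena.Ising3DConformalLimit.Cruxes.LimitRotationInvariant.QuarterTurnLiouville

namespace Summit.CriticalPhenomena.Ising3DConformalLimit.Cruxes.RotationUpgradeFromTwoPoint.SigmaBoundReduction

/-- An entire function that is `T`-periodic on the real axis is `T`-periodic on `ℂ` (identity theorem:
`z ↦ F (z + T)` and `F` are entire and agree on `ℝ`, which accumulates at `0`). [folklore] -/
theorem periodic_of_real_periodic {F : ℂ → ℂ} (hF : Differentiable ℂ F) {T : ℝ}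
    (h : ∀ θ : ℝ, F ((θ : ℂ) + (T : ℂ)) = F (θ : ℂ)) : ∀ z : ℂ, F (z + (T : ℂ)) = F z := by
  have hGd : Differentiable ℂ (fun z : ℂ => F (z + (T : ℂ))) :=
    hF.comp (differentiable_id.add_const _)
  have hGa : AnalyticOnNhd ℂ (fun z : ℂ => F (z + (T : ℂ))) Set.univ :=
    Complex.analyticOnNhd_univ_iff_differentiable.mpr hGd
  have hFa : AnalyticOnNhd ℂ F Set.univ := Complex.analyticOnNhd_univ_iff_differentiable.mpr hF
  have ht : Filter.Tendsto (fun θ : ℝ => (θ : ℂ)) (𝓝[≠] 0) (𝓝[≠] 0) := by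
    have hc : ContinuousWithinAt (fun θ : ℝ => (θ : ℂ)) {(0 : ℝ)}ᶜ 0 :=
      Complex.continuous_ofReal.continuousWithinAt
    have hm : Set.MapsTo (fun θ : ℝ => (θ : ℂ)) {(0 : ℝ)}ᶜ {(0 : ℂ)}ᶜ := by
      intro θ hθ
      simpa using hθ
    simpa using hc.tendsto_nhdsWithin hm
  have hfreq : ∃ᶠ z in 𝓝[≠] (0 : ℂ), (fun z : ℂ => F (z + (T : ℂ))) z = F z :=
    ht.frequently (Filter.Eventually.of_forall fun θ => h θ).frequently
  have key := hGa.eq_of_frequently_eq hFa hfreq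
  intro z
  exact congrFun key z

/-- Level `0`: every family is rotation invariant on the empty configuration. [folklore] -/
theorem rotInvAt_zero (S : CorrFamily 3) : RotInvAt S 0 := by
  intro R x
  congr 1
  funext i
  exact Fin.elim0 i

/-- Level `1`: a translation-invariant family is rotation invariant at one point
(`S 1 y = S 1 0`). [folklore] -/
theorem rotInvAt_one {S : CorrFamily 3} (htr : IsTranslationInvariant S) : RotInvAt S 1 := by
  intro R x
  have h1 : ∀ y : Fin 1 → EuclideanSpace ℝ (Fin 3), S 1 y = S 1 (fun _ => 0) := by
    intro y
    have h := htr 1 (-(y 0)) y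
    rw [← h]
    congr 1
    funext i
    fin_cases i
    simp
  rw [h1 (fun i => R (x i)), h1 x]

/-- Level `2` is MODEL-BLIND from translation invariance and the round kernel (H7) (coincident pairs
included: both sides are `S₂(0,0)`). [folklore] -/
theorem rotInvAt_two {S : CorrFamily 3} (htr : IsTranslationInvariant S)
    (hiso : ∀ (R : EuclideanSpace ℝ (Fin 3) ≃ₗᵢ[ℝ] EuclideanSpace ℝ (Fin 3))
      (x : EuclideanSpace ℝ (Fin 3)), x ≠ 0 → S 2 ![0, R x] = S 2 ![0, x]) :
    RotInvAt S 2 := by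
  have key : ∀ y : Fin 2 → EuclideanSpace ℝ (Fin 3), S 2 y = S 2 ![0, y 1 - y 0] := by
    intro y
    have h := htr 2 (-(y 0)) y
    rw [← h]
    congr 1
    funext i
    fin_cases i <;> simp
    abel
  intro R x
  rw [key (fun i => R (x i)), key x]
  show S 2 ![0, R (x 1) - R (x 0)] = S 2 ![0, x 1 - x 0]
  rw [← map_sub R (x 1) (x 0)]
  by_cases hx : x 1 - x 0 = 0
  · rw [hx, map_zero]
  · exact hiso R _ hx

/-- **The inductive engine, base-free.**  For a family `S` with the limit structure of the line
`quarter-turn-liouville` (`LimitStructure Δ S`: window, translations, dilations, normalisation,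
non-degeneracy, `O_h`, permutation symmetry, Gaussian domination, continuity off diagonals, nine-mirror
reflection positivity), an INDUCTIVE-STEP PROVIDER (at every level `n ≥ 3`, given `O(3)` invariance below
`n`, the orbit function `θ ↦ S n (rot θ ∘ x)` of every axis-generic `x` is the restriction of an entire
function of exponential type `< 4` — the shape of the conclusions of `stub_boostEntireOfType` /
`stub_boostEntireOfTypeAxis`), and `O(3)` invariance at levels `≤ 2`, the family is `O(3)` invariant at
every level.  Strong induction on the level: `orbit_periodic` + `periodic_of_real_periodic` (period `π/2`),
`apply_eq_apply_of_periodic_of_norm_le_exp` (constant), `stub_fourfoldToFull` (axis-generic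
`e₂`-invariance ⇒ `O(3)` at level `n`). [folklore] -/
theorem rotInvAt_all_of_boostEntire {Δ : ℝ} {S : CorrFamily 3} (hL : LimitStructure Δ S)
    (hstep : ∀ n : ℕ, 3 ≤ n → (∀ m < n, RotInvAt S m) →
      ∀ x : Fin n → EuclideanSpace ℝ (Fin 3), AxisGeneric x →
        ∃ F : ℂ → ℂ, Differentiable ℂ F ∧
          (∀ θ : ℝ, F (θ : ℂ) = ((S n (fun i => rot θ (x i)) : ℝ) : ℂ)) ∧
          ∃ C τ : ℝ, τ < 4 ∧ ∀ z : ℂ, ‖F z‖ ≤ C * Real.exp (τ * |z.im|))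
    (h0 : RotInvAt S 0) (h1 : RotInvAt S 1) (h2 : RotInvAt S 2) :
    ∀ n : ℕ, RotInvAt S n := by
  have hO : IsHyperoctahedralInvariant S := hL.1.2.2.2.2.2.1
  intro n
  induction n using Nat.strong_induction_on with
  | _ n ih =>
    rcases Nat.lt_or_ge n 3 with hn | hn
    · interval_cases n
      · exact h0
      · exact h1
      · exact h2
    · refine stub_fourfoldToFull Δ S hL n ?_
      intro x hx θ
      obtain ⟨F, hFd, hFx, C, τ, hτ, hFb⟩ := hstep n hn ih x hx
      -- periodicity of `F`: hyperoctahedral invariance on the real axis + identity theorem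
      have hFp : ∀ z : ℂ, F (z + ((Real.pi / 2 : ℝ) : ℂ)) = F z := by
        refine periodic_of_real_periodic hFd fun θ' => ?_
        have e : (θ' : ℂ) + ((Real.pi / 2 : ℝ) : ℂ) = ((θ' + Real.pi / 2 : ℝ) : ℂ) := by push_cast; ring
        rw [e, hFx, hFx, orbit_periodic hO x θ']
      have hT : (0 : ℝ) < Real.pi / 2 := by positivity
      have hτT : τ * (Real.pi / 2) < 2 * Real.pi := by
        nlinarith [Real.pi_pos, hτ, mul_pos (sub_pos.mpr hτ) Real.pi_pos]
      have hc : F (θ : ℂ) = F ((0 : ℝ) : ℂ) :=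
        Literature.Analysis.Complex.apply_eq_apply_of_periodic_of_norm_le_exp hT hτT hFd hFp hFb _ _
      have e1 : ((S n (fun i => rot θ (x i)) : ℝ) : ℂ) = ((S n (fun i => rot 0 (x i)) : ℝ) : ℂ) := by
        rw [← hFx θ, ← hFx 0]
        exact hc
      have e2 : S n (fun i => rot θ (x i)) = S n (fun i => rot 0 (x i)) := by
        exact_mod_cast e1
      rw [e2]
      congr 1
      funext i
      exact rot_zero_apply (x i)

/-- **`RotationUpgradeFromTwoPoint` ⇐ the two-sided sigma bound for round instances.**
If every instance `(ρ, Δ, S)` of the hypotheses (H1)–(H7) of the crux satisfies the TWO-SIDED SIGMA BOUND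
`TwoSidedSigmaBound Δ S` of the line `quarter-turn-liouville` (in the Osterwalder–Schrader space of each of
the nine lattice frames, one spin inserted on the mirror between a reflected bra cluster combination pushed
to height `≥ u` and a ket combination pushed to height `≥ v` costs `C (u^{-Δ} + v^{-Δ})` relative to the two
OS norms — the correlation-function form of `‖e^{-uH} σ̂(y) e^{-vH}‖ ≤ C (u^{-Δ} + v^{-Δ})`, true for the
generalised free field of dimension `Δ ≥ 1/2`), then the crux holds.  Proof: the landed
`quarter-turn-liouville` machinery (`stub_limitRegularity`, `stub_nineMirrorRP`, `stub_diamondCross`,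
`stub_inPlaneLightCone`, `stub_boostEntireOfType`) supplies `LimitStructure Δ S`, the in-plane light cone
and the inductive step from (H1)–(H6); levels `0, 1, 2` are `rotInvAt_zero/one/two` ((H5), (H7));
`rotInvAt_all_of_boostEntire` does the rest.  The sibling crux `HyperoctahedralRP.LimitRotationInvariant`
differs only in taking level `2` from `HRP2Rigidity`: both isotropy cruxes are thereby closed modulo the
same open bound (for the present one, only round families need it). [folklore] -/
theorem rotationUpgradeFromTwoPoint_of_twoSidedSigmaBound
    (hSB : ∀ (ρ : ℝ → ℝ) (Δ : ℝ) (S : CorrFamily 3), CruxHyp ρ Δ S →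
      (∀ (R : EuclideanSpace ℝ (Fin 3) ≃ₗᵢ[ℝ] EuclideanSpace ℝ (Fin 3))
        (x : EuclideanSpace ℝ (Fin 3)), x ≠ 0 → S 2 ![0, R x] = S 2 ![0, x]) →
      TwoSidedSigmaBound Δ S) :
    Summit.CriticalPhenomena.Ising3DConformalLimit.Theses.GaussianScaleMixture.RotationUpgradeFromTwoPoint := by
  intro ρ Δ S hρ hlim hnorm hnd htr hsc hiso
  have hH : CruxHyp ρ Δ S := ⟨hρ, hlim, hnorm, hnd, htr, hsc⟩
  have hreg : LimitRegularity Δ S := stub_limitRegularity ρ Δ S hH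
  have hL : LimitStructure Δ S := ⟨hreg, stub_nineMirrorRP ρ Δ S hH⟩
  have hcone : InPlaneLightCone S := stub_inPlaneLightCone stub_diamondCross Δ S hL
  have key := rotInvAt_all_of_boostEntire hL
    (stub_boostEntireOfType Δ S hL hcone (hSB ρ Δ S hH hiso))
    (rotInvAt_zero S) (rotInvAt_one htr) (rotInvAt_two htr hiso)
  exact (isRotationInvariant_iff_rotInvAt S).2 key

/-- **`RotationUpgradeFromTwoPoint` ⇐ the frame-`e₀` AXIS sigma bound for round instances** (the weakest
form: verbatim the hypothesis of the landed `stub_boostEntireOfTypeAxis`, i.e. the open stub S3'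
`stub_axisSigmaBound` of the line `quarter-turn-liouville`, here moreover restricted to instances with round
`S₂`).  One spin inserted on the mirror `x₀ = 0` between a reflected bra cluster combination pushed to height
`≥ u` and a ket combination pushed to height `≥ v` costs `C (u^{-Δ} + v^{-Δ})` relative to the two
Osterwalder–Schrader norms.  Same proof as `rotationUpgradeFromTwoPoint_of_twoSidedSigmaBound`, with the
inductive step supplied by `stub_boostEntireOfTypeAxis`. [folklore] -/
theorem rotationUpgradeFromTwoPoint_of_axisSigmaBound
    (hSB : ∀ (ρ : ℝ → ℝ) (Δ : ℝ) (S : CorrFamily 3), CruxHyp ρ Δ S →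
      (∀ (R : EuclideanSpace ℝ (Fin 3) ≃ₗᵢ[ℝ] EuclideanSpace ℝ (Fin 3))
        (x : EuclideanSpace ℝ (Fin 3)), x ≠ 0 → S 2 ![0, R x] = S 2 ![0, x]) →
      ∃ C : ℝ, ∀ u v : ℝ, 0 < u → 0 < v → ∀ y : EuclideanSpace ℝ (Fin 3), y 0 = 0 →
        ∀ (m : ℕ) (k : Fin m → ℕ) (A : (a : Fin m) → Fin (k a) → EuclideanSpace ℝ (Fin 3)) (c : Fin m → ℝ)
          (m' : ℕ) (k' : Fin m' → ℕ) (B : (b : Fin m') → Fin (k' b) → EuclideanSpace ℝ (Fin 3))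
          (d : Fin m' → ℝ),
          (∀ a i, 0 < A a i 0) → (∀ b j, 0 < B b j 0) →
          (∑ a, ∑ b, c a * d b * S (k a + 1 + k' b)
              (Fin.append (Fin.append (fun i => axisReflection 0 (A a i + u • EuclideanSpace.single 0 1)) ![y])
                (fun j => B b j + v • EuclideanSpace.single 0 1))) ^ 2
            ≤ (C * (u ^ (-Δ) + v ^ (-Δ))) ^ 2 *
              (∑ a, ∑ a', c a * c a' * S (k a + k a')
                (Fin.append (fun i => axisReflection 0 (A a i)) (A a'))) *
              (∑ b, ∑ b', d b * d b' * S (k' b + k' b')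
                (Fin.append (fun j => axisReflection 0 (B b j)) (B b')))) :
    Summit.CriticalPhenomena.Ising3DConformalLimit.Theses.GaussianScaleMixture.RotationUpgradeFromTwoPoint := by
  intro ρ Δ S hρ hlim hnorm hnd htr hsc hiso
  have hH : CruxHyp ρ Δ S := ⟨hρ, hlim, hnorm, hnd, htr, hsc⟩
  have hreg : LimitRegularity Δ S := stub_limitRegularity ρ Δ S hH
  have hL : LimitStructure Δ S := ⟨hreg, stub_nineMirrorRP ρ Δ S hH⟩
  have hcone : InPlaneLightCone S := stub_inPlaneLightCone stub_diamondCross Δ S hL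
  have key := rotInvAt_all_of_boostEntire hL
    (stub_boostEntireOfTypeAxis Δ S hL hcone (hSB ρ Δ S hH hiso))
    (rotInvAt_zero S) (rotInvAt_one htr) (rotInvAt_two htr hiso)
  exact (isRotationInvariant_iff_rotInvAt S).2 key

/-- **Per-instance form of the graft.**  ONE instance `(ρ, Δ, S)` of the crux hypotheses (H1)–(H7) that
satisfies the frame-`e₀` axis sigma bound is `O(3)` invariant at all levels (same proof; this is the
shape consumed as STUB 6 `stub_sigmaBoundGraft` by the skeleton of line `null-laplacian-edge-gaussianity`).
[folklore] -/
theorem isRotationInvariant_of_axisSigmaBound {ρ : ℝ → ℝ} {Δ : ℝ} {S : CorrFamily 3}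
    (hH : CruxHyp ρ Δ S)
    (hiso : ∀ (R : EuclideanSpace ℝ (Fin 3) ≃ₗᵢ[ℝ] EuclideanSpace ℝ (Fin 3))
      (x : EuclideanSpace ℝ (Fin 3)), x ≠ 0 → S 2 ![0, R x] = S 2 ![0, x])
    (hsig : ∃ C : ℝ, ∀ u v : ℝ, 0 < u → 0 < v → ∀ y : EuclideanSpace ℝ (Fin 3), y 0 = 0 →
        ∀ (m : ℕ) (k : Fin m → ℕ) (A : (a : Fin m) → Fin (k a) → EuclideanSpace ℝ (Fin 3)) (c : Fin m → ℝ)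
          (m' : ℕ) (k' : Fin m' → ℕ) (B : (b : Fin m') → Fin (k' b) → EuclideanSpace ℝ (Fin 3))
          (d : Fin m' → ℝ),
          (∀ a i, 0 < A a i 0) → (∀ b j, 0 < B b j 0) →
          (∑ a, ∑ b, c a * d b * S (k a + 1 + k' b)
              (Fin.append (Fin.append (fun i => axisReflection 0 (A a i + u • EuclideanSpace.single 0 1)) ![y])
                (fun j => B b j + v • EuclideanSpace.single 0 1))) ^ 2
            ≤ (C * (u ^ (-Δ) + v ^ (-Δ))) ^ 2 *
              (∑ a, ∑ a', c a * c a' * S (k a + k a')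
                (Fin.append (fun i => axisReflection 0 (A a i)) (A a'))) *
              (∑ b, ∑ b', d b * d b' * S (k' b + k' b')
                (Fin.append (fun j => axisReflection 0 (B b j)) (B b')))) :
    IsRotationInvariant S := by
  have htr : IsTranslationInvariant S := hH.2.2.2.2.1
  have hreg : LimitRegularity Δ S := stub_limitRegularity ρ Δ S hH
  have hL : LimitStructure Δ S := ⟨hreg, stub_nineMirrorRP ρ Δ S hH⟩
  have hcone : InPlaneLightCone S := stub_inPlaneLightCone stub_diamondCross Δ S hL
  have key := rotInvAt_all_of_boostEntire hL
    (stub_boostEntireOfTypeAxis Δ S hL hcone hsig)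
    (rotInvAt_zero S) (rotInvAt_one htr) (rotInvAt_two htr hiso)
  exact (isRotationInvariant_iff_rotInvAt S).2 key

end Summit.CriticalPhenomena.Ising3DConformalLimit.Cruxes.RotationUpgradeFromTwoPoint.SigmaBoundReduction

namespace Summit.CriticalPhenomena.Ising3DConformalLimit.Cruxes.RotationUpgradeFromTwoPoint.NullLaplacianEdgeGaussianity

/-- **STUB 6 · `stub_sigmaBoundGraft` of line `null-laplacian-edge-gaussianity`** (registered signature,
verbatim): for every instance of the crux hypotheses (H1)–(H7), the frame-`e₀` axis sigma bound implies
`O(3)` invariance — `SigmaBoundReduction.isRotationInvariant_of_axisSigmaBound`. [folklore] -/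
theorem stub_sigmaBoundGraft :
    ∀ (ρ : ℝ → ℝ) (Δ : ℝ) (S : CorrFamily 3), (∀ δ ∈ Set.Ioc (0:ℝ) 1, 0 < ρ δ) →
      HasPointwiseScalingLimit (criticalCorr 3) ρ S →
      (∀ n z, z ∉ NonCoincident 3 n → S n z = 0) → IsNondegenerateTwoPoint S →
      IsTranslationInvariant S → IsScaleCovariant Δ S →
      (∀ (R : EuclideanSpace ℝ (Fin 3) ≃ₗᵢ[ℝ] EuclideanSpace ℝ (Fin 3))
        (x : EuclideanSpace ℝ (Fin 3)), x ≠ 0 → S 2 ![0, R x] = S 2 ![0, x]) →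
      (∃ C : ℝ, ∀ u v : ℝ, 0 < u → 0 < v → ∀ y : EuclideanSpace ℝ (Fin 3), y 0 = 0 →
        ∀ (m : ℕ) (k : Fin m → ℕ) (A : (a : Fin m) → Fin (k a) → EuclideanSpace ℝ (Fin 3)) (c : Fin m → ℝ)
          (m' : ℕ) (k' : Fin m' → ℕ) (B : (b : Fin m') → Fin (k' b) → EuclideanSpace ℝ (Fin 3))
          (d : Fin m' → ℝ),
          (∀ a i, 0 < A a i 0) → (∀ b j, 0 < B b j 0) →
          (∑ a, ∑ b, c a * d b * S (k a + 1 + k' b)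
              (Fin.append (Fin.append
                (fun i => axisReflection 0 (A a i + u • EuclideanSpace.single 0 1)) ![y])
                (fun j => B b j + v • EuclideanSpace.single 0 1))) ^ 2
            ≤ (C * (u ^ (-Δ) + v ^ (-Δ))) ^ 2 *
              (∑ a, ∑ a', c a * c a' * S (k a + k a')
                (Fin.append (fun i => axisReflection 0 (A a i)) (A a'))) *
              (∑ b, ∑ b', d b * d b' * S (k' b + k' b')
                (Fin.append (fun j => axisReflection 0 (B b j)) (B b')))) →
      IsRotationInvariant S :=
  fun _ _ _ h1 h2 h3 h4 h5 h6 h7 hsig =>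
    SigmaBoundReduction.isRotationInvariant_of_axisSigmaBound ⟨h1, h2, h3, h4, h5, h6⟩ h7 hsig

end Summit.CriticalPhenomena.Ising3DConformalLimit.Cruxes.RotationUpgradeFromTwoPoint.NullLaplacianEdgeGaussianity



/-! ## Addendum (append, lead c1 2026-08-16): the UNIT (dimensionless) form of the graft, through the landed
`stub_axisSigmaBound_of_unit` (p101104) of line `quarter-turn-liouville` -/

namespace Summit.CriticalPhenomena.Ising3DConformalLimit.Cruxes.RotationUpgradeFromTwoPoint.SigmaBoundReduction

/-- **Per-instance graft from the UNIT sigma bound.**  ONE instance `(ρ, Δ, S)` of the crux hypotheses (H1)–(H7)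
whose frame-`e₀` Osterwalder–Schrader space carries the dimensionless bound `‖e^{-H} σ̂(y) e^{-H}‖ ≤ C₁`
(correlation-function form: one spin on the mirror `x₀ = 0` between a reflected bra cluster combination pushed to
height `1` and a ket combination pushed to height `1`) is `O(3)` invariant at all levels: the landed
`stub_axisSigmaBound_of_unit` (scale covariance + contraction of the transfer semigroup) turns the unit bound into the
two-sided bound `C (u^{-Δ} + v^{-Δ})`, and `isRotationInvariant_of_axisSigmaBound` concludes. This is the exact shape
of the open core S3'b `stub_unitSigmaBound` of line `quarter-turn-liouville` (crux stmt-1980). [folklore] -/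
theorem isRotationInvariant_of_unitSigmaBound {ρ : ℝ → ℝ} {Δ : ℝ} {S : CorrFamily 3}
    (hH : CruxHyp ρ Δ S)
    (hiso : ∀ (R : EuclideanSpace ℝ (Fin 3) ≃ₗᵢ[ℝ] EuclideanSpace ℝ (Fin 3))
      (x : EuclideanSpace ℝ (Fin 3)), x ≠ 0 → S 2 ![0, R x] = S 2 ![0, x])
    (hunit : ∃ C₁ : ℝ, ∀ y : EuclideanSpace ℝ (Fin 3), y 0 = 0 →
        ∀ (m : ℕ) (k : Fin m → ℕ) (A : (a : Fin m) → Fin (k a) → EuclideanSpace ℝ (Fin 3)) (c : Fin m → ℝ)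
          (m' : ℕ) (k' : Fin m' → ℕ) (B : (b : Fin m') → Fin (k' b) → EuclideanSpace ℝ (Fin 3))
          (d : Fin m' → ℝ),
          (∀ a i, 0 < A a i 0) → (∀ b j, 0 < B b j 0) →
          (∑ a, ∑ b, c a * d b * S (k a + 1 + k' b)
              (Fin.append (Fin.append (fun i => axisReflection 0 (A a i + EuclideanSpace.single 0 1)) ![y])
                (fun j => B b j + EuclideanSpace.single 0 1))) ^ 2
            ≤ C₁ ^ 2 *
              (∑ a, ∑ a', c a * c a' * S (k a + k a')
                (Fin.append (fun i => axisReflection 0 (A a i)) (A a'))) *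
              (∑ b, ∑ b', d b * d b' * S (k' b + k' b')
                (Fin.append (fun j => axisReflection 0 (B b j)) (B b')))) :
    IsRotationInvariant S := by
  have hreg : LimitRegularity Δ S := stub_limitRegularity ρ Δ S hH
  have hL : LimitStructure Δ S := ⟨hreg, stub_nineMirrorRP ρ Δ S hH⟩
  exact isRotationInvariant_of_axisSigmaBound hH hiso (stub_axisSigmaBound_of_unit Δ S hL hunit)

/-- **`RotationUpgradeFromTwoPoint` ⇐ the UNIT sigma bound for round instances** (the weakest form in this file:
dimensionless, frame `e₀` only, round instances only). [folklore] -/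
theorem rotationUpgradeFromTwoPoint_of_unitSigmaBound
    (hSB : ∀ (ρ : ℝ → ℝ) (Δ : ℝ) (S : CorrFamily 3), CruxHyp ρ Δ S →
      (∀ (R : EuclideanSpace ℝ (Fin 3) ≃ₗᵢ[ℝ] EuclideanSpace ℝ (Fin 3))
        (x : EuclideanSpace ℝ (Fin 3)), x ≠ 0 → S 2 ![0, R x] = S 2 ![0, x]) →
      ∃ C₁ : ℝ, ∀ y : EuclideanSpace ℝ (Fin 3), y 0 = 0 →
        ∀ (m : ℕ) (k : Fin m → ℕ) (A : (a : Fin m) → Fin (k a) → EuclideanSpace ℝ (Fin 3)) (c : Fin m → ℝ)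
          (m' : ℕ) (k' : Fin m' → ℕ) (B : (b : Fin m') → Fin (k' b) → EuclideanSpace ℝ (Fin 3))
          (d : Fin m' → ℝ),
          (∀ a i, 0 < A a i 0) → (∀ b j, 0 < B b j 0) →
          (∑ a, ∑ b, c a * d b * S (k a + 1 + k' b)
              (Fin.append (Fin.append (fun i => axisReflection 0 (A a i + EuclideanSpace.single 0 1)) ![y])
                (fun j => B b j + EuclideanSpace.single 0 1))) ^ 2
            ≤ C₁ ^ 2 *
              (∑ a, ∑ a', c a * c a' * S (k a + k a')
                (Fin.append (fun i => axisReflection 0 (A a i)) (A a'))) *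
              (∑ b, ∑ b', d b * d b' * S (k' b + k' b')
                (Fin.append (fun j => axisReflection 0 (B b j)) (B b')))) :
    Summit.CriticalPhenomena.Ising3DConformalLimit.Theses.GaussianScaleMixture.RotationUpgradeFromTwoPoint := by
  intro ρ Δ S hρ hlim hnorm hnd htr hsc hiso
  exact isRotationInvariant_of_unitSigmaBound ⟨hρ, hlim, hnorm, hnd, htr, hsc⟩ hiso
    (hSB ρ Δ S ⟨hρ, hlim, hnorm, hnd, htr, hsc⟩ hiso)

end Summit.CriticalPhenomena.Ising3DConformalLimit.Cruxes.RotationUpgradeFromTwoPoint.SigmaBoundReduction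

end
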